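import Mathlib
import Literature.AlgebraicGeometry.Resolution.LipmanProcedure
import Literature.AlgebraicGeometry.Resolution.ProjectiveSpaceRegular
import Literature.AlgebraicGeometry.Resolution.AlterationsProofs
import Summits.ResolutionOfSingularities.ResolutionOfSingularities.Theorems.WildQuotientsWildQuotientResolutionBlowupExitSingularLocusRestrict

/-!
# Regularity of `Bl_{Sing X}(X)` is local on `X`; one or two canonical steps give a resolution

(crux stmt-ResolutionOfSingularities-15640 `WildQuotients.WildQuotientResolution`, line `Sketch`,
R-rung of `L/w45c/CHAIN.md` v8 «general twisted root charts»: complement to stub-5's (γ2)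
`…BlowupExitSingularLocusRestrict` («`Bl_{Sing}` commutes with open / flat-preimmersion / étale
charts») for the FRAME of idea-2's `RT-LADDER.md` §2 / §6(e) THESIS J₅/J₆ — the canonical rule
`Y ↦ Bl_{(Sing Y)_red} Y` needs no gluing data; this seat's part per STATUS 2026-08-27T10:34Z.
[OURS · L1 W4.5c] — NOT a statement of any manuscript; replaces the role of no printed item.)

Vocabulary: the tree's `Literature.AlgebraicGeometry.Resolution.singularLocusIdeal X f` (vanishing
ideal sheaf of `X ∖ Reg X`) and the chosen blowing-up `singBlowup.π X f : singBlowup X f ⟶ X`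
(`LipmanProcedure.lean`; `X` locally of finite type over a field via `f : X ⟶ Spec k`), and stub-5's
`BlowupExit.isBlowup_morphismRestrict_singularLocusIdeal`. Results (def-free):
* `exists_iso_restrict_singBlowup` — `Bl_{Sing X}(X) ×_X U ≅ Bl_{Sing U}(U)` over an open `U ⊆ X`
  (the chosen models; uniqueness of blowing-ups);
* `isRegular_of_isBlowup_of_forall_exists`, `isRegular_of_isBlowup_of_iSup_eq_top`,
  `isRegular_singBlowup_of_iSup_eq_top` — **regularity of `Bl_{Sing X}(X)` is LOCAL on `X`**: if `X`
  is covered by opens `U` each admitting SOME regular blowing-up along `𝓘_{Sing U}` (e.g. an explicit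
  toric model of a chart), the source of EVERY blowing-up of `X` along `𝓘_{Sing X}` is regular
  (regularity is tested on the jointly surjective open immersions `π⁻¹(U) ↪ X'`, and `π⁻¹(U)` is
  isomorphic to the given regular model by uniqueness of blowing-ups);
* `hasResolution_of_isRegular_singBlowup`, `hasResolution_of_isRegular_singBlowup_singBlowup`,
  `hasResolution_of_isBirational_of_isRegular_singBlowup_singBlowup` — the TOP of the frame: one or
  two canonical steps with regular outcome, after a proper birational integral model `ρ : Y ⟶ X`
  (THESIS J₅: `Y = Bl_w𝔸⁵/σ`, two steps), give `Scheme.HasResolution X`.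
-/

-- single-problem summit: the doubled namespace component `ResolutionOfSingularities` is forced
set_option linter.dupNamespace false

noncomputable section

open CategoryTheory AlgebraicGeometry TopologicalSpace
open Literature.AlgebraicGeometry.Resolution

universe u

namespace Summit.ResolutionOfSingularities.ResolutionOfSingularities.Theorems.WildQuotientResolution.SingBlowupLocal

variable {k : Type u} [Field k] (X : Scheme.{u}) (f : X ⟶ Spec (.of k)) [LocallyOfFiniteType f]

/-- The chosen blowing-up of the singular locus restricts: `Bl_{Sing X}(X) ×_X U` is the chosen
`Bl_{Sing U}(U)` up to an isomorphism over `U`. [OURS · L1 W4.5c] [folklore] -/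
theorem exists_iso_restrict_singBlowup (U : X.Opens) :
    ∃ e : ((singBlowup.π X f) ⁻¹ᵁ U : Scheme.{u}) ≅ singBlowup (U : Scheme.{u}) (U.ι ≫ f),
      e.hom ≫ singBlowup.π (U : Scheme.{u}) (U.ι ≫ f) = singBlowup.π X f ∣_ U ∧
      e.inv ≫ (singBlowup.π X f ∣_ U) = singBlowup.π (U : Scheme.{u}) (U.ι ≫ f) :=
  (BlowupExit.isBlowup_morphismRestrict_singularLocusIdeal f (blowup.isBlowup _) U).unique
    (blowup.isBlowup _)

/-- **Regularity of `Bl_{Sing X}(X)` is local on `X`**: if every point of `X` has an open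
neighbourhood `U` admitting a regular blowing-up along `𝓘_{Sing U}`, then the source of every
blowing-up of `X` along `𝓘_{Sing X}` is regular. [OURS · L1 W4.5c] [folklore] -/
theorem isRegular_of_isBlowup_of_forall_exists {X' : Scheme.{u}} {π : X' ⟶ X}
    (hπ : IsBlowup π (singularLocusIdeal X f))
    (h : ∀ x : X, ∃ (U : X.Opens) (Y : Scheme.{u}) (τ : Y ⟶ (U : Scheme.{u})), x ∈ U ∧
      IsBlowup τ (singularLocusIdeal (U : Scheme.{u}) (U.ι ≫ f)) ∧ Scheme.IsRegular Y) :
    Scheme.IsRegular X' := by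
  refine Scheme.IsRegular.of_forall_exists_isOpenImmersion fun x' => ?_
  obtain ⟨U, Y, τ, hxU, hτ, hY⟩ := h (π x')
  obtain ⟨e, -, -⟩ := (BlowupExit.isBlowup_morphismRestrict_singularLocusIdeal f hπ U).unique hτ
  refine ⟨(π ⁻¹ᵁ U : Scheme.{u}), (π ⁻¹ᵁ U).ι, inferInstance, ?_,
    Scheme.IsRegular.of_isOpenImmersion e.hom hY⟩
  rw [Scheme.Opens.range_ι]
  exact hxU

/-- Indexed-cover form of `isRegular_of_isBlowup_of_forall_exists`: for an open cover `X = ⋃ Uᵢ`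
with regular blowing-ups `τᵢ : Yᵢ ⟶ Uᵢ` along `𝓘_{Sing Uᵢ}`, every blowing-up of `X` along
`𝓘_{Sing X}` has regular source. [OURS · L1 W4.5c] [folklore] -/
theorem isRegular_of_isBlowup_of_iSup_eq_top {X' : Scheme.{u}} {π : X' ⟶ X}
    (hπ : IsBlowup π (singularLocusIdeal X f)) {ι : Type*} (U : ι → X.Opens)
    (hU : ⨆ i, U i = ⊤) (Y : ι → Scheme.{u}) (τ : ∀ i, Y i ⟶ (U i : Scheme.{u}))
    (hτ : ∀ i, IsBlowup (τ i) (singularLocusIdeal (U i : Scheme.{u}) ((U i).ι ≫ f)))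
    (hY : ∀ i, Scheme.IsRegular (Y i)) : Scheme.IsRegular X' := by
  refine isRegular_of_isBlowup_of_forall_exists X f hπ fun x => ?_
  have hx : x ∈ ⨆ i, U i := by rw [hU]; trivial
  obtain ⟨i, hi⟩ := Opens.mem_iSup.mp hx
  exact ⟨U i, Y i, τ i, hi, hτ i, hY i⟩

/-- The chosen `Bl_{Sing X}(X)` is regular as soon as the chosen `Bl_{Sing Uᵢ}(Uᵢ)` are, for an open
cover `X = ⋃ Uᵢ`. [OURS · L1 W4.5c] [folklore] -/
theorem isRegular_singBlowup_of_iSup_eq_top {ι : Type*} (U : ι → X.Opens) (hU : ⨆ i, U i = ⊤)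
    (hY : ∀ i, Scheme.IsRegular (singBlowup (U i : Scheme.{u}) ((U i).ι ≫ f))) :
    Scheme.IsRegular (singBlowup X f) :=
  isRegular_of_isBlowup_of_iSup_eq_top X f (blowup.isBlowup _) U hU _ _
    (fun _ => blowup.isBlowup _) hY

/-- **One canonical step**: if `Bl_{Sing X}(X)` is regular then the integral `X` has a resolution of
singularities (`Bl_{Sing X}(X) → X` is proper and birational). [OURS · L1 W4.5c] [folklore] -/
theorem hasResolution_of_isRegular_singBlowup [IsIntegral X]
    (h : Scheme.IsRegular (singBlowup X f)) : Scheme.HasResolution X :=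
  Scheme.HasResolution.of_isBirational (singBlowup.π X f) (singBlowup.isBirational X f)
    h.hasResolution

/-- **Two canonical steps** (the shape of idea-2's THESIS J₅: `Bl_{Sing} Bl_{Sing} Y` regular): if
`Bl_{Sing X₁}(X₁)` is regular for `X₁ = Bl_{Sing X}(X)`, then `X` has a resolution of singularities.
[OURS · L1 W4.5c] [folklore] -/
theorem hasResolution_of_isRegular_singBlowup_singBlowup [IsIntegral X]
    (h : Scheme.IsRegular (singBlowup (singBlowup X f) (singBlowup.π X f ≫ f))) :
    Scheme.HasResolution X :=
  Scheme.HasResolution.of_isBirational (singBlowup.π X f) (singBlowup.isBirational X f)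
    (hasResolution_of_isRegular_singBlowup (singBlowup X f) (singBlowup.π X f ≫ f) h)

/-- **Resolutions descend along a proper birational model and two canonical steps**: if
`ρ : Y ⟶ X` is proper birational between integral schemes and `Bl_{Sing} Bl_{Sing} Y` is regular,
then `X` has a resolution (THESIS J₅: `Y = Bl_w𝔸⁵/σ → 𝔸⁵/σ`). [OURS · L1 W4.5c] [folklore] -/
theorem hasResolution_of_isBirational_of_isRegular_singBlowup_singBlowup [IsIntegral X]
    {Y : Scheme.{u}} [IsIntegral Y] (ρ : Y ⟶ X) [IsProper ρ] (hρ : IsBirational ρ)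
    (h : Scheme.IsRegular (singBlowup (singBlowup Y (ρ ≫ f)) (singBlowup.π Y (ρ ≫ f) ≫ ρ ≫ f))) :
    Scheme.HasResolution X :=
  Scheme.HasResolution.of_isBirational ρ hρ
    (hasResolution_of_isRegular_singBlowup_singBlowup Y (ρ ≫ f) h)

end Summit.ResolutionOfSingularities.ResolutionOfSingularities.Theorems.WildQuotientResolution.SingBlowupLocal

end
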